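import Literature.Geometry.Lorentzian.SchwarzschildKerrSchildFrame
import Literature.Geometry.Lorentzian.RicciDecay
import Literature.Geometry.Lorentzian.Einstein
import HarnessLib

/-!
# The Schwarzschild metric in ingoing Kerr–Schild Cartesian coordinates, IV: Ricci-flatness

The Schwarzschild metric `g_{M,0} = η + (2M/r) ℓ ⊗ ℓ`, `ℓ = (1, x⃗/r)`, on the Kerr–Schild chart
domains `Kerr.region 0 r₀ = {r > max r₀ 0} ⊆ E4` is a solution of the Einstein vacuum equations:
**`Ric(g_{M,0}) = 0`** for all real `M`, `r₀` — the `a = 0` case of the named fact `Kerr.isRicciFlat`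
of `KerrSchild.lean` (`Kerr.isRicciFlat_zero_spin`), hence the vacuum property of the spacetimes
`Kerr.spacetime M 0 r₀ hM` / `Schwarzschild.exteriorSpacetime M hM`
(`Kerr.ricci_smoothMetric_zero_spin`). Schwarzschild 1916; Kerr–Schild 1965, §3; O'Neill 1995,
Ch. 2, Thm. 2.6.1.

Proof: at a point `x` off the time axis expand in the adapted orthonormal frame `c` of
`SchwarzschildKerrSchildFrame.lean` (`c 0 = ∂₀`, `c 3 = n♯`); the coordinate formula
`OpensChart.ricci_eq_coord` (`RicciDecay.lean`) with the closed forms of the Koszul form and of its derivative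
(`Schwarzschild.koszulForm_eq_kForm`, `Schwarzschild.fderiv_koszulForm_zero_spin`) and the explicit
inverse Gram matrix `Schwarzschild.ginvMat` (`ricci_frame_aux`) collapses, component by component,
to rational identities in `M` and `r` closed by `field_simp`/`ring` (`ricci_frame`). Classically:
in the unimodular Kerr–Schild coordinates `R_{μν} = ∂_λ Γ^λ_{μν} − Γ^λ_{νσ} Γ^σ_{μλ}` and both
terms equal `(2M²/r⁴) ℓ_μ ℓ_ν`.

## References

* K. Schwarzschild, Sitzungsber. Preuss. Akad. Wiss. (1916) 189; R. P. Kerr, A. Schild (1965), §3.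
* B. O'Neill, *The geometry of Kerr black holes* (1995), Ch. 2, Thm. 2.6.1; *Semi-Riemannian
  geometry* (1983), Ch. 3, Lemma 3.38, Lemma 3.52.
-/

noncomputable section

set_option maxSynthPendingDepth 3

open Bundle TopologicalSpace Manifold Set Module Filter
open scoped ContDiff Topology InnerProductSpace

namespace Literature.Geometry.Lorentzian

namespace Schwarzschild

/-! ### The Ricci tensor of the Schwarzschild metric vanishes -/

section Ricci

/-- Points of `Kerr.region 0 r₀` lie off the time axis (`r = ‖x⃗‖ > 0`). [cite: arXiv08110354, §5.1] -/
theorem spatial_ne_zero_of_mem_region {r₀ : ℝ} (x : Kerr.region 0 r₀) : E4.spatial (x : E4) ≠ 0 := by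
  have h := Kerr.radius_pos_of_mem_region x.2
  rw [Kerr.radius_zero_left, E4.spatialNorm] at h
  exact norm_pos_iff.1 h

variable [Kerr.Facts] (M r₀ : ℝ) (x : Kerr.region 0 r₀) [(Kerr.smoothMetric M 0 r₀).HasLeviCivita]
  (c : OrthonormalBasis (Fin 4) ℝ E4) (hc0 : c 0 = E4.basisVector 0)
  (hc3 : c 3 = radialVector (x : E4))

include hc0 hc3 in
/-- **The frame components of the Ricci tensor of the Schwarzschild metric, explicitly**: in the
adapted frame `c`, `Ric_x(c k, c l)` is the coordinate expression `OpensChart.ricci_eq_coord`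
with inverse Gram matrix `ginvMat M x`, Koszul form `kForm M x` and Koszul-form derivative
`dkForm M x` (O'Neill 1983, Ch. 3, Lemma 3.38 and Lemma 3.52). [cite: ONeill1983, Ch. 3, Lemma 3.52] -/
theorem ricci_frame_aux (k l : Fin 4) :
    (Kerr.smoothMetric M 0 r₀).ricci x (c k) (c l) =
      ∑ i, ∑ j, ginvMat M x j i *
        (2⁻¹ * (dkForm M x (c i) (c l) (c k) (c j) - dkForm M x (c k) (c l) (c i) (c j))
          - ∑ a, ∑ b, ginvMat M x b a *
              (2⁻¹ * kForm M x (c j) (c i) (c b)) * (2⁻¹ * kForm M x (c l) (c k) (c a))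
          + ∑ a, ∑ b, ginvMat M x b a *
              (2⁻¹ * kForm M x (c j) (c k) (c b)) * (2⁻¹ * kForm M x (c l) (c i) (c a))) := by
  have hx : E4.spatial (x : E4) ≠ 0 := spatial_ne_zero_of_mem_region x
  have hG : ∀ y : Kerr.region 0 r₀,
      (Kerr.smoothMetric M 0 r₀).toPseudoRiemannianMetric.val y = Kerr.bilin M 0 y := fun y ↦ rfl
  set β : Module.Basis (Fin 4) ℝ (TangentSpace 𝓘(ℝ, E4) x) := c.toBasis with hβdef
  have hβ : ∀ i, β i = c i := fun i ↦ congrFun c.coe_toBasis i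
  rw [← hβ k, ← hβ l, OpensChart.ricci_eq_coord hG x β k l]
  simp only [hβ]
  rw [gram_frame_inv hx c hc0 hc3]
  simp only [fderiv_koszulForm_zero_spin M hx, koszulForm_eq_kForm M hx]

include hc0 hc3 in
/-- `Ric(c 0, c 0) = 0` in an adapted frame (see `ricci_frame`). [cite: KerrSchild1965, §3] -/
private theorem ricci_frame_00 : (Kerr.smoothMetric M 0 r₀).ricci x (c 0) (c 0) = 0 := by
  have hx : E4.spatial (x : E4) ≠ 0 := spatial_ne_zero_of_mem_region x
  have hr : E4.spatialNorm (x : E4) ≠ 0 := by rwa [E4.spatialNorm, norm_ne_zero_iff]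
  rw [ricci_frame_aux M r₀ x c hc0 hc3]
  simp only [ginvMat, Fin.sum_univ_four, Matrix.of_apply, Matrix.cons_val', Matrix.cons_val_zero,
    Matrix.cons_val_one, Matrix.cons_val, Matrix.empty_val', Matrix.cons_val_fin_one, Fin.isValue,
    zero_mul, add_zero, zero_add]
  simp only [dkForm, kForm, dkCore, kCore, ell_frame hx c hc0 hc3, nu_frame hx c hc3,
    proj_frame hx c hc0 hc3, dEll_frame hx c hc0 hc3, dProj_frame hx c hc0 hc3,
    sdot_frame_left hx c hc3, tI, rI, dI, Fin.isValue, Fin.reduceEq, if_true, if_false, mul_one,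
    one_mul, mul_zero, zero_mul, add_zero, zero_add, sub_zero, zero_sub, zero_div, neg_zero]
  field_simp
  ring

include hc0 hc3 in
/-- `Ric(c 0, c 1) = 0` in an adapted frame (see `ricci_frame`). [cite: KerrSchild1965, §3] -/
private theorem ricci_frame_01 : (Kerr.smoothMetric M 0 r₀).ricci x (c 0) (c 1) = 0 := by
  have hx : E4.spatial (x : E4) ≠ 0 := spatial_ne_zero_of_mem_region x
  rw [ricci_frame_aux M r₀ x c hc0 hc3]
  simp only [ginvMat, Fin.sum_univ_four, Matrix.of_apply, Matrix.cons_val', Matrix.cons_val_zero,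
    Matrix.cons_val_one, Matrix.cons_val, Matrix.empty_val', Matrix.cons_val_fin_one, Fin.isValue,
    zero_mul, add_zero, zero_add]
  simp only [dkForm, kForm, dkCore, kCore, ell_frame hx c hc0 hc3, nu_frame hx c hc3,
    proj_frame hx c hc0 hc3, dEll_frame hx c hc0 hc3, dProj_frame hx c hc0 hc3,
    sdot_frame_left hx c hc3, tI, rI, dI, Fin.isValue, Fin.reduceEq, if_true, if_false, mul_one,
    one_mul, mul_zero, zero_mul, add_zero, zero_add, sub_zero, zero_sub, zero_div, neg_zero]

include hc0 hc3 in
/-- `Ric(c 0, c 2) = 0` in an adapted frame (see `ricci_frame`). [cite: KerrSchild1965, §3] -/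
private theorem ricci_frame_02 : (Kerr.smoothMetric M 0 r₀).ricci x (c 0) (c 2) = 0 := by
  have hx : E4.spatial (x : E4) ≠ 0 := spatial_ne_zero_of_mem_region x
  rw [ricci_frame_aux M r₀ x c hc0 hc3]
  simp only [ginvMat, Fin.sum_univ_four, Matrix.of_apply, Matrix.cons_val', Matrix.cons_val_zero,
    Matrix.cons_val_one, Matrix.cons_val, Matrix.empty_val', Matrix.cons_val_fin_one, Fin.isValue,
    zero_mul, add_zero, zero_add]
  simp only [dkForm, kForm, dkCore, kCore, ell_frame hx c hc0 hc3, nu_frame hx c hc3,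
    proj_frame hx c hc0 hc3, dEll_frame hx c hc0 hc3, dProj_frame hx c hc0 hc3,
    sdot_frame_left hx c hc3, tI, rI, dI, Fin.isValue, Fin.reduceEq, if_true, if_false, mul_one,
    one_mul, mul_zero, zero_mul, add_zero, zero_add, sub_zero, zero_sub, zero_div, neg_zero]

include hc0 hc3 in
/-- `Ric(c 0, c 3) = 0` in an adapted frame (see `ricci_frame`). [cite: KerrSchild1965, §3] -/
private theorem ricci_frame_03 : (Kerr.smoothMetric M 0 r₀).ricci x (c 0) (c 3) = 0 := by
  have hx : E4.spatial (x : E4) ≠ 0 := spatial_ne_zero_of_mem_region x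
  have hr : E4.spatialNorm (x : E4) ≠ 0 := by rwa [E4.spatialNorm, norm_ne_zero_iff]
  rw [ricci_frame_aux M r₀ x c hc0 hc3]
  simp only [ginvMat, Fin.sum_univ_four, Matrix.of_apply, Matrix.cons_val', Matrix.cons_val_zero,
    Matrix.cons_val_one, Matrix.cons_val, Matrix.empty_val', Matrix.cons_val_fin_one, Fin.isValue,
    zero_mul, add_zero, zero_add]
  simp only [dkForm, kForm, dkCore, kCore, ell_frame hx c hc0 hc3, nu_frame hx c hc3,
    proj_frame hx c hc0 hc3, dEll_frame hx c hc0 hc3, dProj_frame hx c hc0 hc3,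
    sdot_frame_left hx c hc3, tI, rI, dI, Fin.isValue, Fin.reduceEq, if_true, if_false, mul_one,
    one_mul, mul_zero, zero_mul, add_zero, zero_add, sub_zero, zero_sub, zero_div, neg_zero]
  field_simp
  ring

include hc0 hc3 in
/-- `Ric(c 1, c 0) = 0` in an adapted frame (see `ricci_frame`). [cite: KerrSchild1965, §3] -/
private theorem ricci_frame_10 : (Kerr.smoothMetric M 0 r₀).ricci x (c 1) (c 0) = 0 := by
  have hx : E4.spatial (x : E4) ≠ 0 := spatial_ne_zero_of_mem_region x
  rw [ricci_frame_aux M r₀ x c hc0 hc3]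
  simp only [ginvMat, Fin.sum_univ_four, Matrix.of_apply, Matrix.cons_val', Matrix.cons_val_zero,
    Matrix.cons_val_one, Matrix.cons_val, Matrix.empty_val', Matrix.cons_val_fin_one, Fin.isValue,
    zero_mul, add_zero, zero_add]
  simp only [dkForm, kForm, dkCore, kCore, ell_frame hx c hc0 hc3, nu_frame hx c hc3,
    proj_frame hx c hc0 hc3, dEll_frame hx c hc0 hc3, dProj_frame hx c hc0 hc3,
    sdot_frame_left hx c hc3, tI, rI, dI, Fin.isValue, Fin.reduceEq, if_true, if_false, mul_one,
    mul_zero, zero_mul, add_zero, zero_add, sub_zero, zero_sub, zero_div, neg_zero]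

include hc0 hc3 in
/-- `Ric(c 1, c 1) = 0` in an adapted frame (see `ricci_frame`). [cite: KerrSchild1965, §3] -/
private theorem ricci_frame_11 : (Kerr.smoothMetric M 0 r₀).ricci x (c 1) (c 1) = 0 := by
  have hx : E4.spatial (x : E4) ≠ 0 := spatial_ne_zero_of_mem_region x
  have hr : E4.spatialNorm (x : E4) ≠ 0 := by rwa [E4.spatialNorm, norm_ne_zero_iff]
  rw [ricci_frame_aux M r₀ x c hc0 hc3]
  simp only [ginvMat, Fin.sum_univ_four, Matrix.of_apply, Matrix.cons_val', Matrix.cons_val_zero,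
    Matrix.cons_val_one, Matrix.cons_val, Matrix.empty_val', Matrix.cons_val_fin_one, Fin.isValue,
    zero_mul, add_zero, zero_add]
  simp only [dkForm, kForm, dkCore, kCore, ell_frame hx c hc0 hc3, nu_frame hx c hc3,
    proj_frame hx c hc0 hc3, dEll_frame hx c hc0 hc3, dProj_frame hx c hc0 hc3,
    sdot_frame_left hx c hc3, tI, rI, dI, Fin.isValue, Fin.reduceEq, if_true, if_false, mul_one,
    one_mul, mul_zero, zero_mul, add_zero, zero_add, sub_zero, zero_sub, zero_div, neg_zero]
  field_simp
  ring

include hc0 hc3 in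
/-- `Ric(c 1, c 2) = 0` in an adapted frame (see `ricci_frame`). [cite: KerrSchild1965, §3] -/
private theorem ricci_frame_12 : (Kerr.smoothMetric M 0 r₀).ricci x (c 1) (c 2) = 0 := by
  have hx : E4.spatial (x : E4) ≠ 0 := spatial_ne_zero_of_mem_region x
  rw [ricci_frame_aux M r₀ x c hc0 hc3]
  simp only [ginvMat, Fin.sum_univ_four, Matrix.of_apply, Matrix.cons_val', Matrix.cons_val_zero,
    Matrix.cons_val_one, Matrix.cons_val, Matrix.empty_val', Matrix.cons_val_fin_one, Fin.isValue,
    zero_mul, add_zero, zero_add]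
  simp only [dkForm, kForm, dkCore, kCore, ell_frame hx c hc0 hc3, nu_frame hx c hc3,
    proj_frame hx c hc0 hc3, dEll_frame hx c hc0 hc3, dProj_frame hx c hc0 hc3,
    sdot_frame_left hx c hc3, tI, rI, dI, Fin.isValue, Fin.reduceEq, if_true, if_false, mul_one,
    mul_zero, zero_mul, add_zero, zero_add, sub_zero, zero_sub, zero_div, neg_zero]

include hc0 hc3 in
/-- `Ric(c 1, c 3) = 0` in an adapted frame (see `ricci_frame`). [cite: KerrSchild1965, §3] -/
private theorem ricci_frame_13 : (Kerr.smoothMetric M 0 r₀).ricci x (c 1) (c 3) = 0 := by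
  have hx : E4.spatial (x : E4) ≠ 0 := spatial_ne_zero_of_mem_region x
  rw [ricci_frame_aux M r₀ x c hc0 hc3]
  simp only [ginvMat, Fin.sum_univ_four, Matrix.of_apply, Matrix.cons_val', Matrix.cons_val_zero,
    Matrix.cons_val_one, Matrix.cons_val, Matrix.empty_val', Matrix.cons_val_fin_one, Fin.isValue,
    zero_mul, add_zero, zero_add]
  simp only [dkForm, kForm, dkCore, kCore, ell_frame hx c hc0 hc3, nu_frame hx c hc3,
    proj_frame hx c hc0 hc3, dEll_frame hx c hc0 hc3, dProj_frame hx c hc0 hc3,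
    sdot_frame_left hx c hc3, tI, rI, dI, Fin.isValue, Fin.reduceEq, if_true, if_false, mul_one,
    one_mul, mul_zero, zero_mul, add_zero, zero_add, sub_zero, zero_sub, zero_div, neg_zero]

include hc0 hc3 in
/-- `Ric(c 2, c 0) = 0` in an adapted frame (see `ricci_frame`). [cite: KerrSchild1965, §3] -/
private theorem ricci_frame_20 : (Kerr.smoothMetric M 0 r₀).ricci x (c 2) (c 0) = 0 := by
  have hx : E4.spatial (x : E4) ≠ 0 := spatial_ne_zero_of_mem_region x
  rw [ricci_frame_aux M r₀ x c hc0 hc3]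
  simp only [ginvMat, Fin.sum_univ_four, Matrix.of_apply, Matrix.cons_val', Matrix.cons_val_zero,
    Matrix.cons_val_one, Matrix.cons_val, Matrix.empty_val', Matrix.cons_val_fin_one, Fin.isValue,
    zero_mul, add_zero, zero_add]
  simp only [dkForm, kForm, dkCore, kCore, ell_frame hx c hc0 hc3, nu_frame hx c hc3,
    proj_frame hx c hc0 hc3, dEll_frame hx c hc0 hc3, dProj_frame hx c hc0 hc3,
    sdot_frame_left hx c hc3, tI, rI, dI, Fin.isValue, Fin.reduceEq, if_true, if_false, mul_one,
    mul_zero, zero_mul, add_zero, zero_add, sub_zero, zero_sub, zero_div, neg_zero]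

include hc0 hc3 in
/-- `Ric(c 2, c 1) = 0` in an adapted frame (see `ricci_frame`). [cite: KerrSchild1965, §3] -/
private theorem ricci_frame_21 : (Kerr.smoothMetric M 0 r₀).ricci x (c 2) (c 1) = 0 := by
  have hx : E4.spatial (x : E4) ≠ 0 := spatial_ne_zero_of_mem_region x
  rw [ricci_frame_aux M r₀ x c hc0 hc3]
  simp only [ginvMat, Fin.sum_univ_four, Matrix.of_apply, Matrix.cons_val', Matrix.cons_val_zero,
    Matrix.cons_val_one, Matrix.cons_val, Matrix.empty_val', Matrix.cons_val_fin_one, Fin.isValue,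
    zero_mul, add_zero, zero_add]
  simp only [dkForm, kForm, dkCore, kCore, ell_frame hx c hc0 hc3, nu_frame hx c hc3,
    proj_frame hx c hc0 hc3, dEll_frame hx c hc0 hc3, dProj_frame hx c hc0 hc3,
    sdot_frame_left hx c hc3, tI, rI, dI, Fin.isValue, Fin.reduceEq, if_true, if_false, mul_one,
    mul_zero, zero_mul, add_zero, zero_add, sub_zero, zero_sub, zero_div, neg_zero]

include hc0 hc3 in
/-- `Ric(c 2, c 2) = 0` in an adapted frame (see `ricci_frame`). [cite: KerrSchild1965, §3] -/
private theorem ricci_frame_22 : (Kerr.smoothMetric M 0 r₀).ricci x (c 2) (c 2) = 0 := by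
  have hx : E4.spatial (x : E4) ≠ 0 := spatial_ne_zero_of_mem_region x
  have hr : E4.spatialNorm (x : E4) ≠ 0 := by rwa [E4.spatialNorm, norm_ne_zero_iff]
  rw [ricci_frame_aux M r₀ x c hc0 hc3]
  simp only [ginvMat, Fin.sum_univ_four, Matrix.of_apply, Matrix.cons_val', Matrix.cons_val_zero,
    Matrix.cons_val_one, Matrix.cons_val, Matrix.empty_val', Matrix.cons_val_fin_one, Fin.isValue,
    zero_mul, add_zero, zero_add]
  simp only [dkForm, kForm, dkCore, kCore, ell_frame hx c hc0 hc3, nu_frame hx c hc3,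
    proj_frame hx c hc0 hc3, dEll_frame hx c hc0 hc3, dProj_frame hx c hc0 hc3,
    sdot_frame_left hx c hc3, tI, rI, dI, Fin.isValue, Fin.reduceEq, if_true, if_false, mul_one,
    one_mul, mul_zero, zero_mul, add_zero, zero_add, sub_zero, zero_sub, zero_div, neg_zero]
  field_simp
  ring

include hc0 hc3 in
/-- `Ric(c 2, c 3) = 0` in an adapted frame (see `ricci_frame`). [cite: KerrSchild1965, §3] -/
private theorem ricci_frame_23 : (Kerr.smoothMetric M 0 r₀).ricci x (c 2) (c 3) = 0 := by
  have hx : E4.spatial (x : E4) ≠ 0 := spatial_ne_zero_of_mem_region x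
  rw [ricci_frame_aux M r₀ x c hc0 hc3]
  simp only [ginvMat, Fin.sum_univ_four, Matrix.of_apply, Matrix.cons_val', Matrix.cons_val_zero,
    Matrix.cons_val_one, Matrix.cons_val, Matrix.empty_val', Matrix.cons_val_fin_one, Fin.isValue,
    zero_mul, add_zero, zero_add]
  simp only [dkForm, kForm, dkCore, kCore, ell_frame hx c hc0 hc3, nu_frame hx c hc3,
    proj_frame hx c hc0 hc3, dEll_frame hx c hc0 hc3, dProj_frame hx c hc0 hc3,
    sdot_frame_left hx c hc3, tI, rI, dI, Fin.isValue, Fin.reduceEq, if_true, if_false, mul_one,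
    one_mul, mul_zero, zero_mul, add_zero, zero_add, sub_zero, zero_sub, zero_div, neg_zero]

include hc0 hc3 in
/-- `Ric(c 3, c 0) = 0` in an adapted frame (see `ricci_frame`). [cite: KerrSchild1965, §3] -/
private theorem ricci_frame_30 : (Kerr.smoothMetric M 0 r₀).ricci x (c 3) (c 0) = 0 := by
  have hx : E4.spatial (x : E4) ≠ 0 := spatial_ne_zero_of_mem_region x
  have hr : E4.spatialNorm (x : E4) ≠ 0 := by rwa [E4.spatialNorm, norm_ne_zero_iff]
  rw [ricci_frame_aux M r₀ x c hc0 hc3]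
  simp only [ginvMat, Fin.sum_univ_four, Matrix.of_apply, Matrix.cons_val', Matrix.cons_val_zero,
    Matrix.cons_val_one, Matrix.cons_val, Matrix.empty_val', Matrix.cons_val_fin_one, Fin.isValue,
    zero_mul, add_zero, zero_add]
  simp only [dkForm, kForm, dkCore, kCore, ell_frame hx c hc0 hc3, nu_frame hx c hc3,
    proj_frame hx c hc0 hc3, dEll_frame hx c hc0 hc3, dProj_frame hx c hc0 hc3,
    sdot_frame_left hx c hc3, tI, rI, dI, Fin.isValue, Fin.reduceEq, if_true, if_false, mul_one,
    one_mul, mul_zero, zero_mul, add_zero, zero_add, sub_zero, zero_sub, zero_div, neg_zero]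
  field_simp
  ring

include hc0 hc3 in
/-- `Ric(c 3, c 1) = 0` in an adapted frame (see `ricci_frame`). [cite: KerrSchild1965, §3] -/
private theorem ricci_frame_31 : (Kerr.smoothMetric M 0 r₀).ricci x (c 3) (c 1) = 0 := by
  have hx : E4.spatial (x : E4) ≠ 0 := spatial_ne_zero_of_mem_region x
  rw [ricci_frame_aux M r₀ x c hc0 hc3]
  simp only [ginvMat, Fin.sum_univ_four, Matrix.of_apply, Matrix.cons_val', Matrix.cons_val_zero,
    Matrix.cons_val_one, Matrix.cons_val, Matrix.empty_val', Matrix.cons_val_fin_one, Fin.isValue,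
    zero_mul, add_zero, zero_add]
  simp only [dkForm, kForm, dkCore, kCore, ell_frame hx c hc0 hc3, nu_frame hx c hc3,
    proj_frame hx c hc0 hc3, dEll_frame hx c hc0 hc3, dProj_frame hx c hc0 hc3,
    sdot_frame_left hx c hc3, tI, rI, dI, Fin.isValue, Fin.reduceEq, if_true, if_false, mul_one,
    one_mul, mul_zero, zero_mul, add_zero, zero_add, sub_zero, zero_sub, zero_div, neg_zero]

include hc0 hc3 in
/-- `Ric(c 3, c 2) = 0` in an adapted frame (see `ricci_frame`). [cite: KerrSchild1965, §3] -/
private theorem ricci_frame_32 : (Kerr.smoothMetric M 0 r₀).ricci x (c 3) (c 2) = 0 := by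
  have hx : E4.spatial (x : E4) ≠ 0 := spatial_ne_zero_of_mem_region x
  rw [ricci_frame_aux M r₀ x c hc0 hc3]
  simp only [ginvMat, Fin.sum_univ_four, Matrix.of_apply, Matrix.cons_val', Matrix.cons_val_zero,
    Matrix.cons_val_one, Matrix.cons_val, Matrix.empty_val', Matrix.cons_val_fin_one, Fin.isValue,
    zero_mul, add_zero, zero_add]
  simp only [dkForm, kForm, dkCore, kCore, ell_frame hx c hc0 hc3, nu_frame hx c hc3,
    proj_frame hx c hc0 hc3, dEll_frame hx c hc0 hc3, dProj_frame hx c hc0 hc3,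
    sdot_frame_left hx c hc3, tI, rI, dI, Fin.isValue, Fin.reduceEq, if_true, if_false, mul_one,
    one_mul, mul_zero, zero_mul, add_zero, zero_add, sub_zero, zero_sub, zero_div, neg_zero]

include hc0 hc3 in
/-- `Ric(c 3, c 3) = 0` in an adapted frame (see `ricci_frame`). [cite: KerrSchild1965, §3] -/
private theorem ricci_frame_33 : (Kerr.smoothMetric M 0 r₀).ricci x (c 3) (c 3) = 0 := by
  have hx : E4.spatial (x : E4) ≠ 0 := spatial_ne_zero_of_mem_region x
  have hr : E4.spatialNorm (x : E4) ≠ 0 := by rwa [E4.spatialNorm, norm_ne_zero_iff]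
  rw [ricci_frame_aux M r₀ x c hc0 hc3]
  simp only [ginvMat, Fin.sum_univ_four, Matrix.of_apply, Matrix.cons_val', Matrix.cons_val_zero,
    Matrix.cons_val_one, Matrix.cons_val, Matrix.empty_val', Matrix.cons_val_fin_one, Fin.isValue,
    zero_mul, add_zero, zero_add]
  simp only [dkForm, kForm, dkCore, kCore, ell_frame hx c hc0 hc3, nu_frame hx c hc3,
    proj_frame hx c hc0 hc3, dEll_frame hx c hc0 hc3, dProj_frame hx c hc0 hc3,
    sdot_frame_left hx c hc3, tI, rI, dI, Fin.isValue, Fin.reduceEq, if_true, if_false, mul_one,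
    one_mul, mul_zero, zero_mul, add_zero, zero_add, sub_zero, zero_sub, zero_div, neg_zero]
  field_simp
  ring

include hc0 hc3 in
/-- **The frame components of the Ricci tensor of the Schwarzschild metric vanish**: for every
point `x` of `Kerr.region 0 r₀` and an adapted orthonormal frame `c` (`c 0 = ∂₀`, `c 3 = n♯`),
`Ric_x(c k, c l) = 0` for all `k, l` (sixteen rational identities in `M`, `r`). Kerr–Schild 1965,
§3; O'Neill 1995, Ch. 2, Thm. 2.6.1. [cite: KerrSchild1965, §3] -/
theorem ricci_frame (k l : Fin 4) : (Kerr.smoothMetric M 0 r₀).ricci x (c k) (c l) = 0 := by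
  fin_cases k <;> fin_cases l
  exacts [ricci_frame_00 M r₀ x c hc0 hc3, ricci_frame_01 M r₀ x c hc0 hc3, ricci_frame_02 M r₀ x c hc0 hc3, ricci_frame_03 M r₀ x c hc0 hc3,
    ricci_frame_10 M r₀ x c hc0 hc3, ricci_frame_11 M r₀ x c hc0 hc3, ricci_frame_12 M r₀ x c hc0 hc3, ricci_frame_13 M r₀ x c hc0 hc3,
    ricci_frame_20 M r₀ x c hc0 hc3, ricci_frame_21 M r₀ x c hc0 hc3, ricci_frame_22 M r₀ x c hc0 hc3, ricci_frame_23 M r₀ x c hc0 hc3,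
    ricci_frame_30 M r₀ x c hc0 hc3, ricci_frame_31 M r₀ x c hc0 hc3, ricci_frame_32 M r₀ x c hc0 hc3, ricci_frame_33 M r₀ x c hc0 hc3]

/-- **The Ricci tensor of the Schwarzschild metric in ingoing Kerr–Schild coordinates vanishes**
at every point of `Kerr.region 0 r₀` (a bilinear form vanishing on a basis, `ricci_frame`).
Kerr–Schild 1965, §3; O'Neill 1995, Ch. 2, Thm. 2.6.1. [cite: KerrSchild1965, §3] -/
theorem ricci_smoothMetric_zero_spin : (Kerr.smoothMetric M 0 r₀).ricci x = 0 := by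
  obtain ⟨c, hc0, hc3⟩ := exists_orthonormalBasis_adapted (spatial_ne_zero_of_mem_region x)
  have h := ricci_frame M r₀ x c hc0 hc3
  set β : Module.Basis (Fin 4) ℝ (TangentSpace 𝓘(ℝ, E4) x) := c.toBasis with hβdef
  have hβ : ∀ i, β i = c i := fun i ↦ congrFun c.coe_toBasis i
  refine LinearMap.BilinForm.ext_basis β fun k l ↦ ?_
  rw [hβ, hβ, h k l]
  rfl

end Ricci

end Schwarzschild

/-- **The Schwarzschild metric is Ricci-flat** (the `a = 0` case of the named fact
`Kerr.isRicciFlat`): for all real `M` and `r₀`, the Kerr–Schild metric `g_{M,0} = η + (2M/r) ℓ ⊗ ℓ`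
on the chart domain `Kerr.region 0 r₀ = {r > max r₀ 0}` (ingoing Eddington–Finkelstein /
Kerr–Schild Cartesian coordinates; for `M ≥ 0` the metric of the spacetimes `Kerr.spacetime M 0 r₀ hM`,
`Schwarzschild.exteriorSpacetime M hM`) satisfies `Ric = 0`. Schwarzschild 1916; Kerr–Schild 1965,
§3; O'Neill 1995, Ch. 2, Thm. 2.6.1. The curvature is that of the Levi-Civita connection of the
prelude (`LeviCivita.lean`) under its standing hypothesis, at the analytic regularity of
`Kerr.metric` (definitionally the same connection as for `Kerr.smoothMetric`).
[cite: KerrSchild1965, §3] -/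
theorem Kerr.isRicciFlat_zero_spin [Kerr.Facts] (M r₀ : ℝ) : Kerr.isRicciFlat M 0 r₀ := by
  intro h y
  haveI : (Kerr.smoothMetric M 0 r₀).HasLeviCivita := h
  exact Schwarzschild.ricci_smoothMetric_zero_spin M r₀ y

/-- The Schwarzschild metric is Ricci-flat, smooth-regularity form: `Ric(g_{M,0}) = 0` on
`Kerr.region 0 r₀` for the `C^∞` metric `Kerr.smoothMetric M 0 r₀` (the metric of
`Kerr.spacetime M 0 r₀ hM` by `rfl`), i.e. these spacetimes are vacuum. Kerr–Schild 1965, §3;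
O'Neill 1995, Ch. 2, Thm. 2.6.1. [cite: KerrSchild1965, §3] -/
theorem Kerr.ricci_smoothMetric_zero_spin [Kerr.Facts] (M r₀ : ℝ)
    [(Kerr.smoothMetric M 0 r₀).HasLeviCivita] (x : Kerr.region 0 r₀) :
    (Kerr.smoothMetric M 0 r₀).ricci x = 0 :=
  Schwarzschild.ricci_smoothMetric_zero_spin M r₀ x

/-- The Schwarzschild metric is Ricci-flat in the sense of `PseudoRiemannianMetric.IsRicciFlat`
(`Einstein.lean`; the form consumed by `DataEmbedding.IsVacuum` / `VacuumCauchyDevelopment`):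
the `C^∞` Kerr–Schild metric `Kerr.smoothMetric M 0 r₀` on `Kerr.region 0 r₀` satisfies the
Einstein vacuum equations. Kerr–Schild 1965, §3; O'Neill 1983, Ch. 12, pp. 336–337.
[cite: KerrSchild1965, §3] -/
theorem Kerr.isRicciFlat_smoothMetric_zero_spin [Kerr.Facts] (M r₀ : ℝ)
    [(Kerr.smoothMetric M 0 r₀).HasLeviCivita] :
    (Kerr.smoothMetric M 0 r₀).toPseudoRiemannianMetric.IsRicciFlat :=
  fun x ↦ Schwarzschild.ricci_smoothMetric_zero_spin M r₀ x

end Literature.Geometry.Lorentzian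

end
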